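import Summits.QuantumFields.YangMills.Theorems.BalabanUVNodesN15DefectKernelVectorPieceMixed
import Summits.QuantumFields.YangMills.Theorems.BalabanUVNodesN15VectorPiecePlain
import HarnessLib

/-!
# Route «BalabanUVNodes» (K4 «SpineRates»), node N15 = NE2: THE MIXED PIECE `∇_μG∇_ν*` OF THE U = 1 VECTOR SINGLE-SCALE PIECE ON THE UNIT TORUS —
# uniform two-spacing majorants `B·(L^k)^{−min(α,γ)∕2}·e^{−ρ|y−y′|_T}` with ONE set of constants over all direction pairs, and the plain majorants

Cell `pub-ymgap`, seat `pub-ymgap-dag-n15-c` (generation g0; R134 ACCELERATION SEAT, strategy s1 = FIRST-MISSING-ESTIMATE of the background layer's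
OPERATOR inputs; HUMAN RULING D-0062; chair R424 venue; `bears_on: R4∕N15`).  Filed `--supports stmt-QuantumFields-19676` (K3 `SpineGivenEndpointR11`;
helper).  THEOREMS ONLY; imports BY NAME, nothing in the tree modified: this seat's `…DefectKernelVectorPieceMixed` (`hasMaj_idef_vectorPieceMixed_unitTorus`),
n15-a's part 26 `…VectorPiecePlain` (`hasMaj_plain_unitTorus`, `abs_reD_single_le`, `abs_reH_single_le`, `exists_abs_covC_single_le`, `blkFine_comp_kingPrV`,
`fineBond_weight_balance(_fine)`) and through it parts 15∕16 (`kingPr(V)`, `reD`, `covC`, `wTranspose`, `rweight`, `blkFine` and their `_single` lemmas,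
`card_mul_rweight`, `inv_pow_le_rpow`, `rateDConst`, `rateD_le`, `exists_forall_fin_of_forall_exists`).

WHY (n15-b parts B3∕B4 headers: «the mixed `∂H∂*` piece is NOT in the tree — located, not claimed»; n15-a ACK l.12020: «parts 12∕13 never typed the
(3.44)-shaped mixed entry»).  The first-order background layer BY NAME (`…N15.BackgroundLayer.ne2PlusOperator_background₁4`, B4) displays the `U ≡ 1` operator
layer as its only hypotheses; among them the uniform majorant `hSD` of the mixed pieces `(∇_μG∇*)_μ` and the two-lattice η-defects `hDSD` of the pairs
`(∇′_μG′∇′*, ∇_μG∇*)` had no tree theorem on the unit torus (nor had the coarse plain majorant `hD` of `∇_μG`, whose fine twin is part 26's).  THIS FILE supplies both for the vector single-scale piece `G = H_k·C^{(k)}·(η^{d+1}H_kᵀ)`, in the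
currency the joint knits consume (n15-a part 27's pattern: concrete operators, King's pairing as a map, the Riemann weight fixed, ONE constant with the rate
factor pulled out, a rate window `0 ≤ ρ ≤ δ₀`).

CONTENTS.
* §1 `shapeM_le` (the mixed majorant's shape is monotone and homogeneous in its three rate slots); **`hasMaj_entryM`** (per direction pair `(μ, ν)`:
  `∃ B, δ₁ > 0`, for every unit torus `Π ℤ∕M_λ` with `L ∣ M_λ`, all `k`, `m ≥ 1`, `0 ≤ ρ ≤ δ₁`:
  `HasMaj (ofBlocks (unitTorusGeo L k M) blkFine) (ofBlocks … (blkFine ∘ kingPrV)) (𝔇((∂′_μH′)C′(w′(∂′_νH′)ᵀ), (∂_μH)C(w(∂_νH)ᵀ))) (B·(L^k)^{−min(α,γ)∕2}·e^{−ρ|y−y′|_T})`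
  — `…Mixed_unitTorus` at `w = (L^k)^{−(d+1)}`, both derivative rates collected with `rateD_le`, the covariance rate `(L^k)⁻¹ ≤ (L^k)^{−min(α,γ)∕2}`);
  **`hasMaj_mixedEntries`** (ONE `(B, δ₀)` for all `μ, ν`, all tori, `k`, `m ≥ 1`, window `0 ≤ ρ ≤ δ₀` — finite uniformisation twice).
* §2 **`hasMaj_plainMixed_all`**: `∃ β, δ_p > 0`, the PLAIN block majorants `β·e^{−ρ|y−y′|_T}` of the coarse derived piece `∂_μG = (∂_μH_k)·C^{(k)}·(η^{d+1}H_kᵀ)`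
  (part 26 states only its fine twin), of the coarse mixed piece `(∂_μH_k)·C^{(k)}·(η^{d+1}(∂_νH_k)ᵀ)` (blocks `blkFine`) and of its fine twin at level `L^mL^k`
  (blocks `blkFine ∘ kingPrV`), all `μ, ν, k, m`, `0 ≤ ρ ≤ δ_p` (part 26 `hasMaj_plain_unitTorus` ×3) — with §1, EVERY `U ≡ 1` hypothesis of
  `ne2PlusOperator_background₁4` at the vector single-scale piece is now a tree theorem on the unit torus (parts 15∕16∕23∕26 + this file).

HONEST FRAMING ∕ LIMITS.  `U = 1` LINEAR theory on FINITE tori (b05∕b06 torus model), `d + 1 ≥ 2`, one single-scale piece in King's (4.42) SHAPE with Bałaban's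
vector factors; re-packaging of this seat's binder-format theorem and of LANDED decay theorems — no new analytic estimate; rate exponent `min(α,γ)∕2 < ½`;
NOT the multiscale carrier ∕ telescoping over `j` (NODE 00); NE2⁺ proper (U ≠ 1) NOT PRINTED ∕ not proved.  Count-neutral (typed 28∕28 · discharged unchanged);
NOT a discharge of N15; one finite T⁴ at fixed ε — NOT infinite volume, NOT OS on ℝ⁴, NOT a mass gap, NOT Clay.
-/

noncomputable section

open scoped BigOperators
open Finset

namespace Summit.QuantumFields.YangMills.BalabanUVNodes.N15.VectorPiece

open Literature.MathematicalPhysics.QuantumFieldTheory.Balaban1983to89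
open Literature.MathematicalPhysics.QuantumFieldTheory.Balaban1983to89.B11SectG (BlockNorm HasMaj)
open Literature.MathematicalPhysics.QuantumFieldTheory.Balaban1983to89.T4EtaRateDefect (idef)
open Literature.MathematicalPhysics.QuantumFieldTheory.Balaban1983to89.T4EtaRateCoeffDefect (pull)
open Literature.MathematicalPhysics.QuantumFieldTheory.Balaban1983to89.B4TorusKernel (periodConst)
open Literature.MathematicalPhysics.QuantumFieldTheory.Balaban1983to89.B5Prop11Plancherel (Tor fine fdiff)
open Literature.MathematicalPhysics.QuantumFieldTheory.Balaban1983to89.B5Hk163Strip (kappa163 kappa163_pos)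
open Literature.MathematicalPhysics.QuantumFieldTheory.Balaban1983to89.B5Hk163Decay (MG163)
open Literature.MathematicalPhysics.QuantumFieldTheory.Balaban1983to89.B5Hk163Torus (HkOp)
open Literature.MathematicalPhysics.QuantumFieldTheory.Balaban1983to89.B5Hk163TorusHolderDecay (MD163)
open Literature.MathematicalPhysics.QuantumFieldTheory.Balaban1983to89.B5Hk163RateSum (C0maj C1maj T163)
open Literature.MathematicalPhysics.QuantumFieldTheory.Balaban1983to89.T4Hk163StripRate (CGe)
open Literature.MathematicalPhysics.QuantumFieldTheory.Balaban1983to89.B6LowerBound2153Torus (rep rep_mem_pbox)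
open Literature.MathematicalPhysics.QuantumFieldTheory.Balaban1983to89.B6Lemma24Torus (pbox)
open Literature.MathematicalPhysics.QuantumFieldTheory.Balaban1983to89.B6Cov2156Torus (deltaPol bondReductionT)
open Literature.MathematicalPhysics.QuantumFieldTheory.Balaban1983to89.B6UnitTorusCarrier (unitTorusGeo unitTorusGeo_len)
open Literature.MathematicalPhysics.QuantumFieldTheory.King1986 (aliasConst exp_decay_mono)
open Literature.MathematicalPhysics.QuantumFieldTheory.King1986.Torus (blockOf tdistT tdistT_nonneg)
open Summit.QuantumFields.YangMills.BalabanUVNodes.N15.DefectKernel (hasMaj_idef_vectorPieceMixed_unitTorus)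

variable {d : ℕ}

/-! ## §1 The mixed piece `∇_μG∇_ν*` with a uniform majorant `B·(L^k)^{−min(α,γ)∕2}·e^{−ρ|y−y′|_T}` -/

section Majorants

variable {L : ℕ} [NeZero L]

omit [NeZero L] in
/-- Monotonicity of the mixed majorant's shape (the §2 majorant of `…DefectKernelVectorPieceMixed` read at the Riemann weight) in its three rate slots, all
other letters nonnegative. [folklore] -/
theorem shapeM_le {d1 cD cr B₀ S₁ S₂ S₃ K₁ K₂ K₃ t : ℝ} (hd1 : 0 ≤ d1) (hcD : 0 ≤ cD) (hcr : 0 ≤ cr) (hB₀ : 0 ≤ B₀)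
    (h₁ : S₁ ≤ K₁ * t) (h₂ : S₂ ≤ K₂ * t) (h₃ : S₃ ≤ K₃ * t) :
    d1 * cD * cr * (d1 * B₀ * cr * (d1 * S₁) + d1 * S₂ * cr * (d1 * cD)) + d1 * S₃ * cr * (d1 * B₀ * cr * (d1 * cD))
      ≤ (d1 * cD * cr * (d1 * B₀ * cr * (d1 * K₁) + d1 * K₂ * cr * (d1 * cD)) + d1 * K₃ * cr * (d1 * B₀ * cr * (d1 * cD))) * t := by
  calc d1 * cD * cr * (d1 * B₀ * cr * (d1 * S₁) + d1 * S₂ * cr * (d1 * cD)) + d1 * S₃ * cr * (d1 * B₀ * cr * (d1 * cD))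
      ≤ d1 * cD * cr * (d1 * B₀ * cr * (d1 * (K₁ * t)) + d1 * (K₂ * t) * cr * (d1 * cD)) + d1 * (K₃ * t) * cr * (d1 * B₀ * cr * (d1 * cD)) := by
        gcongr
    _ = _ := by ring

/-- **THE MIXED PIECE WITH A UNIFORM MAJORANT** (`…DefectKernel.hasMaj_idef_vectorPieceMixed_unitTorus` at the Riemann weight `w = (L^k)^{−(d+1)}`, rates
collected with part 16's `rateD_le`): for directions `μ, ν` there are `B, δ₁ > 0` such that for every unit torus `Π ℤ∕M_λ` with `L ∣ M_λ`, all `k`, `m ≥ 1`,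
`0 ≤ ρ ≤ δ₁`: `𝔇(∂′_μG′∂′_ν*, ∂_μG∂_ν*)` for the piece `G = H_k·C^{(k)}·(η^{d+1}H_kᵀ)` — the η-difference through King's pairing of the concrete operators
`(∂_μH)·C·(w·(∂_νH)ᵀ)` at the two spacings — has the block majorant `B·(L^k)^{−min(α,γ)∕2}·e^{−ρ|y−y′|_T}` between the sharp cube norms of the fine-bond
assignments. [cite: Balaban1985BackgroundPropagators, (3.44) p.397 (the mixed entry, shape); King1986, (4.42)–(4.43) p.675, Prop. 3.8 (3.71) p.664 (second line); Balaban1984PropagatorsI, (1.63) p.28; Balaban1984PropagatorsII, (2.156) p.250] -/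
theorem hasMaj_entryM (hd : 1 ≤ d) (hL : 1 ≤ L) {α γ : ℝ} (hα0 : 0 ≤ α) (hα1 : α < 1) (hγ0 : 0 < γ) (hγ1 : γ < 1) (μ ν : Fin (d + 1)) :
    ∃ B δ₁ : ℝ, 0 < B ∧ 0 < δ₁ ∧ ∀ (M : Fin (d + 1) → ℕ) [∀ μ, NeZero (M μ)] (_ : ∀ i, L ∣ M i) (k m : ℕ) (_ : 1 ≤ m)
      {ρ : ℝ} (_ : 0 ≤ ρ) (_ : ρ ≤ δ₁),
      HasMaj (BlockNorm.ofBlocks (unitTorusGeo L k M) (blkFine L k M))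
        (BlockNorm.ofBlocks (unitTorusGeo L k M) (blkFine L k M ∘ kingPrV L k m M))
        (idef (pull (kingPrV L k m M)) (pull (kingPrV L k m M))
          (reD M (L ^ m * L ^ k) μ ∘ₗ (covC L M (L ^ (k + m)) ∘ₗ
            wTranspose M (L ^ m * L ^ k) (rweight (d := d) L k / ((L : ℝ) ^ m) ^ (d + 1)) (reD M (L ^ m * L ^ k) ν)))
          (reD M (L ^ k) μ ∘ₗ (covC L M (L ^ k) ∘ₗ wTranspose M (L ^ k) (rweight (d := d) L k) (reD M (L ^ k) ν))))
        (fun y y' => B * ((L : ℝ) ^ k) ^ (-(min α γ / 2)) * Real.exp (-(ρ * tdistT M y y'))) := by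
  obtain ⟨B₀, C₁, δ', hB₀, hC₁, hδ', HP⟩ := hasMaj_idef_vectorPieceMixed_unitTorus (d := d) hd hL hα0 hα1 hγ0 hγ1 μ ν
  have hL0 : L ≠ 0 := by omega
  have hpC0 : 0 ≤ periodConst (kappa163 (d + 1)) d := (B5Kernel166Decay.periodConst_pos (kappa163_pos _) d).le
  have hσ : 0 < min (kappa163 (d + 1) / (d + 1) / 2) δ' / 2 :=
    half_pos (lt_min (half_pos (div_pos (kappa163_pos _) (by positivity))) hδ')
  have hcr0 : 0 ≤ B4Sect5Proof.latticeConst (d + 1) (min (kappa163 (d + 1) / (d + 1) / 2) δ' / 2) :=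
    B4Sect5Proof.latticeConst_nonneg (d + 1) hσ.le
  have hcD : 0 ≤ MD163 (d + 1) * periodConst (kappa163 (d + 1)) d := B5Hk163TorusHolderDecay.CdecD_nonneg
  have hKD := rateDConst_nonneg d hα1 γ
  have hγ₀1 : min α γ / 2 ≤ 1 := by
    have := min_le_left α γ; linarith
  refine ⟨((d + 1 : ℕ) : ℝ) * (MD163 (d + 1) * periodConst (kappa163 (d + 1)) d) *
        B4Sect5Proof.latticeConst (d + 1) (min (kappa163 (d + 1) / (d + 1) / 2) δ' / 2) *
        (((d + 1 : ℕ) : ℝ) * B₀ * B4Sect5Proof.latticeConst (d + 1) (min (kappa163 (d + 1) / (d + 1) / 2) δ' / 2) *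
            (((d + 1 : ℕ) : ℝ) * rateDConst d α γ)
          + ((d + 1 : ℕ) : ℝ) * C₁ * B4Sect5Proof.latticeConst (d + 1) (min (kappa163 (d + 1) / (d + 1) / 2) δ' / 2) *
            (((d + 1 : ℕ) : ℝ) * (MD163 (d + 1) * periodConst (kappa163 (d + 1)) d)))
      + ((d + 1 : ℕ) : ℝ) * rateDConst d α γ *
        B4Sect5Proof.latticeConst (d + 1) (min (kappa163 (d + 1) / (d + 1) / 2) δ' / 2) *
        (((d + 1 : ℕ) : ℝ) * B₀ * B4Sect5Proof.latticeConst (d + 1) (min (kappa163 (d + 1) / (d + 1) / 2) δ' / 2) *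
          (((d + 1 : ℕ) : ℝ) * (MD163 (d + 1) * periodConst (kappa163 (d + 1)) d))) + 1,
    min (kappa163 (d + 1) / (d + 1) / 2) δ' / 2, by positivity, hσ, ?_⟩
  intro M _ hLM k m hm ρ hρ hρ1
  have key := HP M hLM k m hm (kingPr L k m M) (kingPr_val L k m M) (kingPrV L k m M) (fun _ => rfl)
    (reD M (L ^ k) μ) (reD_single M (L ^ k) μ) (reD M (L ^ m * L ^ k) μ) (reD_single M (L ^ m * L ^ k) μ)
    (reD M (L ^ k) ν) (reD_single M (L ^ k) ν) (reD M (L ^ m * L ^ k) ν) (reD_single M (L ^ m * L ^ k) ν)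
    (rweight_nonneg (d := d) L k)
    (wTranspose M (L ^ k) (rweight (d := d) L k) (reD M (L ^ k) ν)) (wTranspose_single M (L ^ k) (rweight (d := d) L k) (reD M (L ^ k) ν))
    (wTranspose M (L ^ m * L ^ k) (rweight (d := d) L k / ((L : ℝ) ^ m) ^ (d + 1)) (reD M (L ^ m * L ^ k) ν))
    (wTranspose_single M (L ^ m * L ^ k) (rweight (d := d) L k / ((L : ℝ) ^ m) ^ (d + 1)) (reD M (L ^ m * L ^ k) ν))
    (covC L M (L ^ k)) (covC_single L M (L ^ k)) (covC L M (L ^ (k + m))) (covC_single L M (L ^ (k + m))) hρ hρ1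
  refine key.mono fun y y' => ?_
  have hbal := card_mul_rweight (d := d) hL0 k
  have hcast : ((L ^ k : ℕ) : ℝ) = (L : ℝ) ^ k := by push_cast; ring
  rw [hbal, hcast]
  have hE : 0 ≤ Real.exp (-(ρ * tdistT M y y')) := Real.exp_nonneg _
  refine mul_le_mul_of_nonneg_right ?_ hE
  have ht : 0 < ((L : ℝ) ^ k) ^ (-(min α γ / 2)) := Real.rpow_pos_of_pos (pow_pos (by exact_mod_cast (show 0 < L by omega)) _) _
  have hinv : ((L : ℝ) ^ k)⁻¹ ≤ ((L : ℝ) ^ k) ^ (-(min α γ / 2)) := inv_pow_le_rpow hL k hγ₀1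
  have h₂ : C₁ * ((L : ℝ) ^ k)⁻¹ ≤ C₁ * ((L : ℝ) ^ k) ^ (-(min α γ / 2)) := mul_le_mul_of_nonneg_left hinv hC₁.le
  have h₃ := rateD_le (d := d) hL k hα0 hα1 hγ0 hγ1
  exact (shapeM_le (by positivity) hcD hcr0 hB₀.le h₃ h₂ h₃).trans
    (mul_le_mul_of_nonneg_right (le_add_of_nonneg_right zero_le_one) ht.le)

/-- **THE MIXED PIECES WITH ONE SET OF CONSTANTS OVER ALL PAIRS OF DIRECTIONS.**  For `d + 1 ≥ 2`, `L ≥ 1`, `0 ≤ α < 1`, `0 < γ < 1` there are `B, δ₀ > 0`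
such that for EVERY unit torus `Π ℤ∕M_λ` with `L ∣ M_λ`, all levels `k`, `m ≥ 1`, all directions `μ, ν` and every `0 ≤ ρ ≤ δ₀`: the two-spacing η-defect
`𝔇(∂′_μG′∂′_ν*, ∂_μG∂_ν*)` of the vector single-scale piece has the block majorant `B·(L^k)^{−min(α,γ)∕2}·e^{−ρ|y−y′|_T}` — the fifth `U ≡ 1` pair
`(∇′_μG′∇′*, ∇_μG∇*)` displayed by the first-order background layer (`…N15.BackgroundLayer.ne2PlusOperator_background₁4`, hypothesis `hDSD`), by name.
[cite: Balaban1985BackgroundPropagators, (3.44) p.397 (shape), Thm 3.1 p.397 (quantifier template); King1986, (4.42)–(4.43) p.675; Balaban1984PropagatorsI, (1.63) p.28; Balaban1984PropagatorsII, (2.156) p.250] -/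
theorem hasMaj_mixedEntries (hd : 1 ≤ d) (hL : 1 ≤ L) {α γ : ℝ} (hα0 : 0 ≤ α) (hα1 : α < 1) (hγ0 : 0 < γ) (hγ1 : γ < 1) :
    ∃ B δ₀ : ℝ, 0 < B ∧ 0 < δ₀ ∧ ∀ (M : Fin (d + 1) → ℕ) [∀ μ, NeZero (M μ)] (_ : ∀ i, L ∣ M i) (k m : ℕ) (_ : 1 ≤ m)
      (μ ν : Fin (d + 1)) {ρ : ℝ} (_ : 0 ≤ ρ) (_ : ρ ≤ δ₀),
      HasMaj (BlockNorm.ofBlocks (unitTorusGeo L k M) (blkFine L k M))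
        (BlockNorm.ofBlocks (unitTorusGeo L k M) (blkFine L k M ∘ kingPrV L k m M))
        (idef (pull (kingPrV L k m M)) (pull (kingPrV L k m M))
          (reD M (L ^ m * L ^ k) μ ∘ₗ (covC L M (L ^ (k + m)) ∘ₗ
            wTranspose M (L ^ m * L ^ k) (rweight (d := d) L k / ((L : ℝ) ^ m) ^ (d + 1)) (reD M (L ^ m * L ^ k) ν)))
          (reD M (L ^ k) μ ∘ₗ (covC L M (L ^ k) ∘ₗ wTranspose M (L ^ k) (rweight (d := d) L k) (reD M (L ^ k) ν))))
        (fun y y' => B * ((L : ℝ) ^ k) ^ (-(min α γ / 2)) * Real.exp (-(ρ * tdistT M y y'))) := by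
  -- the shape `Q μ ν B δ` of the direction-pair statements, monotone in `(B, δ)`
  let Q : Fin (d + 1) → Fin (d + 1) → ℝ → ℝ → Prop := fun μ ν B δ => ∀ (M : Fin (d + 1) → ℕ) [∀ μ, NeZero (M μ)] (_ : ∀ i, L ∣ M i)
      (k m : ℕ) (_ : 1 ≤ m) {ρ : ℝ} (_ : 0 ≤ ρ) (_ : ρ ≤ δ),
      HasMaj (BlockNorm.ofBlocks (unitTorusGeo L k M) (blkFine L k M))
        (BlockNorm.ofBlocks (unitTorusGeo L k M) (blkFine L k M ∘ kingPrV L k m M))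
        (idef (pull (kingPrV L k m M)) (pull (kingPrV L k m M))
          (reD M (L ^ m * L ^ k) μ ∘ₗ (covC L M (L ^ (k + m)) ∘ₗ
            wTranspose M (L ^ m * L ^ k) (rweight (d := d) L k / ((L : ℝ) ^ m) ^ (d + 1)) (reD M (L ^ m * L ^ k) ν)))
          (reD M (L ^ k) μ ∘ₗ (covC L M (L ^ k) ∘ₗ wTranspose M (L ^ k) (rweight (d := d) L k) (reD M (L ^ k) ν))))
        (fun y y' => B * ((L : ℝ) ^ k) ^ (-(min α γ / 2)) * Real.exp (-(ρ * tdistT M y y')))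
  have hmonoQ : ∀ μ ν B δ B' δ', B ≤ B' → δ' ≤ δ → Q μ ν B δ → Q μ ν B' δ' := by
    intro μ ν B δ B' δ' hBB' hδδ' h M _ hLM k m hm ρ hρ hρ1
    exact (h M hLM k m hm hρ (hρ1.trans hδδ')).mono fun y y' =>
      mul_le_mul_of_nonneg_right (mul_le_mul_of_nonneg_right hBB' (Real.rpow_nonneg (by positivity) _)) (Real.exp_nonneg _)
  -- uniformise over `ν` for each `μ`, then over `μ`
  have hP : ∀ μ, ∃ B δ : ℝ, 0 < B ∧ 0 < δ ∧ ∀ ν, Q μ ν B δ := by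
    intro μ
    refine exists_forall_fin_of_forall_exists (Q μ) (hmonoQ μ) fun ν => ?_
    obtain ⟨B, δ, hB, hδ, H⟩ := hasMaj_entryM (d := d) hd hL hα0 hα1 hγ0 hγ1 μ ν
    exact ⟨B, δ, hB, hδ, fun M _ hLM k m hm ρ hρ hρ1 => H M hLM k m hm hρ hρ1⟩
  obtain ⟨B, δ₀, hB, hδ₀, H⟩ := exists_forall_fin_of_forall_exists (fun μ B δ => ∀ ν, Q μ ν B δ)
    (fun μ B δ B' δ' hBB' hδδ' h ν => hmonoQ μ ν B δ B' δ' hBB' hδδ' (h ν)) hP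
  exact ⟨B, δ₀, hB, hδ₀, fun M _ hLM k m hm μ ν ρ hρ hρ1 => H μ ν M hLM k m hm hρ hρ1⟩

end Majorants

/-! ## §2 The plain majorants the first-order layer reads beyond part 26: the coarse `∂_μG` and the mixed pieces at both spacings, ONE uniform `(β, δ_p)` -/

section Plain

variable {L : ℕ} [NeZero L]

/-- **THE PLAIN MAJORANTS OF THE COARSE DERIVED PIECE AND OF THE MIXED PIECES, ONE UNIFORM `(β, δ_p)`.**  For `d + 1 ≥ 2`, `L ≥ 1` there are `β, δ_p > 0`
such that for every unit torus `Π ℤ∕M_λ` with `L ∣ M_λ`, all levels `k`, `m`, all directions `μ, ν` and every `0 ≤ ρ ≤ δ_p`, on the carrier `unitTorusGeo L k M`: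
(D₁) the COARSE derived piece `∂_μG = (∂_μH_k)·C^{(k)}·(η^{d+1}H_kᵀ)` (blocks `blkFine`; part 26 states only its fine twin), (SD) the coarse mixed piece
`∂_μG∂_ν* = (∂_μH_k)·C^{(k)}·(η^{d+1}(∂_νH_k)ᵀ)` (blocks `blkFine`) and (SD′) its fine twin at level `L^mL^k` (weight `η^{d+1}∕(L^m)^{d+1}`, blocks
`blkFine ∘ kingPrV`) all have the block majorant `β·e^{−ρ|y−y′|_T}` — part 26's `hasMaj_plain_unitTorus` with the kernel decays `abs_reD_single_le` ∕
`abs_reH_single_le`; (D₁) and (SD) are the `hD` ∕ `hSD` hypotheses of `…N15.BackgroundLayer.ne2PlusOperator_background₁4`, by name.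
[cite: King1986, (4.42) p.675 (the piece); Balaban1984PropagatorsI, (1.63) p.28, (1.31) p.23; Balaban1984PropagatorsII, (2.156) p.250, (2.52)–(2.55) pp.232–233] -/
theorem hasMaj_plainMixed_all (hd : 1 ≤ d) (hL : 1 ≤ L) :
    ∃ β δp : ℝ, 0 < β ∧ 0 < δp ∧ ∀ (M : Fin (d + 1) → ℕ) [∀ μ, NeZero (M μ)] (_ : ∀ i, L ∣ M i) (k m : ℕ) (μ ν : Fin (d + 1))
      {ρ : ℝ} (_ : 0 ≤ ρ) (_ : ρ ≤ δp),
      HasMaj (BlockNorm.ofBlocks (unitTorusGeo L k M) (blkFine L k M)) (BlockNorm.ofBlocks (unitTorusGeo L k M) (blkFine L k M))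
          (reD M (L ^ k) μ ∘ₗ (covC L M (L ^ k) ∘ₗ wTranspose M (L ^ k) (rweight (d := d) L k) (reH M (L ^ k))))
          (fun y y' => β * Real.exp (-(ρ * tdistT M y y')))
      ∧ HasMaj (BlockNorm.ofBlocks (unitTorusGeo L k M) (blkFine L k M)) (BlockNorm.ofBlocks (unitTorusGeo L k M) (blkFine L k M))
          (reD M (L ^ k) μ ∘ₗ (covC L M (L ^ k) ∘ₗ wTranspose M (L ^ k) (rweight (d := d) L k) (reD M (L ^ k) ν)))
          (fun y y' => β * Real.exp (-(ρ * tdistT M y y')))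
      ∧ HasMaj (BlockNorm.ofBlocks (unitTorusGeo L k M) (blkFine L k M ∘ kingPrV L k m M))
          (BlockNorm.ofBlocks (unitTorusGeo L k M) (blkFine L k M ∘ kingPrV L k m M))
          (reD M (L ^ m * L ^ k) μ ∘ₗ (covC L M (L ^ (k + m)) ∘ₗ
            wTranspose M (L ^ m * L ^ k) (rweight (d := d) L k / ((L : ℝ) ^ m) ^ (d + 1)) (reD M (L ^ m * L ^ k) ν)))
          (fun y y' => β * Real.exp (-(ρ * tdistT M y y'))) := by
  obtain ⟨B₀, δ₀, hB₀, hδ₀, HC⟩ := exists_abs_covC_single_le (d := d) hd hL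
  have hL0 : L ≠ 0 := by omega
  have hpC : 0 < periodConst (kappa163 (d + 1)) d := B5Kernel166Decay.periodConst_pos (kappa163_pos _) d
  have hMG : 0 ≤ MG163 (d + 1) := B5Hk163Decay.MG163_nonneg _
  have hMD : 0 ≤ MD163 (d + 1) := (mul_nonneg_iff_of_pos_right hpC).mp (B5Hk163TorusHolderDecay.CdecD_nonneg (d := d))
  have hδH : 0 < kappa163 (d + 1) / (d + 1) := div_pos (kappa163_pos _) (by positivity)
  -- the common constants: `a₀` dominates both kernel constants, `δ_p` is half the smaller decay rate
  set c₀ : ℝ := MG163 (d + 1) * periodConst (kappa163 (d + 1)) d with hc₀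
  set cD : ℝ := MD163 (d + 1) * periodConst (kappa163 (d + 1)) d with hcD
  set a₀ : ℝ := c₀ + cD with ha₀
  have hc₀0 : 0 ≤ c₀ := mul_nonneg hMG hpC.le
  have hcD0 : 0 ≤ cD := mul_nonneg hMD hpC.le
  have ha₀0 : 0 ≤ a₀ := by positivity
  have hc₀a : c₀ ≤ a₀ := by rw [ha₀]; linarith
  have hcDa : cD ≤ a₀ := by rw [ha₀]; linarith
  set δp : ℝ := min (kappa163 (d + 1) / (d + 1)) δ₀ / 2 with hδp
  have hδp0 : 0 < δp := half_pos (lt_min hδH hδ₀)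
  set Kσ : ℝ := B4Sect5Proof.latticeConst (d + 1) δp with hKσ
  have hKσ0 : 0 ≤ Kσ := B4Sect5Proof.latticeConst_nonneg (d + 1) hδp0.le
  set β : ℝ := (((d + 1 : ℕ) : ℝ) * a₀ * Kσ) * ((((d + 1 : ℕ) : ℝ) * B₀ * Kσ) * (((d + 1 : ℕ) : ℝ) * a₀)) + 1 with hβ
  refine ⟨β, δp, by positivity, hδp0, ?_⟩
  intro M _ hLM k m μ ν ρ hρ hρp
  -- the window: `ρ + δ_p ≤ 2δ_p ≤` each decay rate
  have h2 : ρ + δp ≤ min (kappa163 (d + 1) / (d + 1)) δ₀ := by rw [hδp] at hρp ⊢; linarith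
  have hρH : ρ + δp ≤ kappa163 (d + 1) / (d + 1) := h2.trans (min_le_left _ _)
  have hρ0 : ρ + δp ≤ δ₀ := h2.trans (min_le_right _ _)
  -- entry decays with the common constant `a₀`
  have hH : ∀ (nn : ℕ) [NeZero nn] (b : Tor M × Fin (d + 1)) (i : Tor (fine nn M) × Fin (d + 1)),
      |reH M nn (Pi.single b 1) i| ≤ a₀ * Real.exp (-(kappa163 (d + 1) / (d + 1) * tdistT M (blockOf nn M i.1) b.1)) := fun nn _ b i =>
    (abs_reH_single_le M nn b i).trans (mul_le_mul_of_nonneg_right hc₀a (Real.exp_nonneg _))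
  have hD : ∀ (nn : ℕ) [NeZero nn] (lam : Fin (d + 1)) (b : Tor M × Fin (d + 1)) (i : Tor (fine nn M) × Fin (d + 1)),
      |reD M nn lam (Pi.single b 1) i| ≤ a₀ * Real.exp (-(kappa163 (d + 1) / (d + 1) * tdistT M (blockOf nn M i.1) b.1)) :=
    fun nn _ lam b i => (abs_reD_single_le M nn lam b i).trans (mul_le_mul_of_nonneg_right hcDa (Real.exp_nonneg _))
  have hCk : ∀ (kk : ℕ) (b b' : Tor M × Fin (d + 1)), |covC L M (L ^ kk) (Pi.single b' 1) b| ≤ B₀ * Real.exp (-(δ₀ * tdistT M b.1 b'.1)) :=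
    fun kk b b' => HC M hLM kk b b'
  -- the uniform bound `β` dominates the composite's constant
  have hmono : ∀ y y' : Tor M,
      (((d + 1 : ℕ) : ℝ) * a₀ * Kσ) * ((((d + 1 : ℕ) : ℝ) * B₀ * Kσ) * (((d + 1 : ℕ) : ℝ) * a₀)) * Real.exp (-(ρ * tdistT M y y'))
        ≤ β * Real.exp (-(ρ * tdistT M y y')) := fun y y' =>
    mul_le_mul_of_nonneg_right (by rw [hβ]; linarith) (Real.exp_nonneg _)
  have hwk : 0 ≤ rweight (d := d) L k := rweight_nonneg L k
  have hwk' : 0 ≤ rweight (d := d) L k / ((L : ℝ) ^ m) ^ (d + 1) := div_nonneg hwk (pow_nonneg (pow_nonneg (Nat.cast_nonneg _) _) _)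
  have hfine : blkFine L k M ∘ kingPrV L k m M = fun i' : Tor (fine (L ^ m * L ^ k) M) × Fin (d + 1) => blockOf (L ^ m * L ^ k) M i'.1 :=
    blkFine_comp_kingPrV M L k m
  refine ⟨?_, ?_, ?_⟩
  · exact (hasMaj_plain_unitTorus (L := L) M k k (L ^ k) hB₀.le (hCk k) ha₀0 ha₀0 (hD (L ^ k) μ) (hH (L ^ k)) hwk
      (fineBond_weight_balance hL0 k) hδp0 hρ hρH hρH hρ0).mono hmono
  · exact (hasMaj_plain_unitTorus (L := L) M k k (L ^ k) hB₀.le (hCk k) ha₀0 ha₀0 (hD (L ^ k) μ) (hD (L ^ k) ν) hwk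
      (fineBond_weight_balance hL0 k) hδp0 hρ hρH hρH hρ0).mono hmono
  · rw [hfine]
    exact (hasMaj_plain_unitTorus (L := L) M k (k + m) (L ^ m * L ^ k) hB₀.le (hCk (k + m)) ha₀0 ha₀0 (hD (L ^ m * L ^ k) μ)
      (hD (L ^ m * L ^ k) ν) hwk' (fineBond_weight_balance_fine hL0 k m) hδp0 hρ hρH hρH hρ0).mono hmono

end Plain

end Summit.QuantumFields.YangMills.BalabanUVNodes.N15.VectorPiece
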